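import Summits.Ventures.HSemireg.WedgeHankelRecurrenceGaussDiscreteFamilies

/-!
# Venture HSemireg — **THE REVERSED RECURRENCE IS THE SECOND KIND, AND THE PERSYMMETRIC JACOBI MATRICES (de Boor–Golub)**: for `q_0 = 1`, `q_1 = X − a_0`, `q_{n+2} = (X − a_{n+1}) q_{n+1} − b_{n+1} q_n`,
# the REVERSED data `A_i = a_{t−i}`, `B_i = b_{t+1−i}` produce `Q_t = r_{t+1}` (the second-kind ∕ associated polynomial), hence by the Casoratian `q_t Q_t − q_{t+1} r_t = b_1⋯b_t` and
# **`q_t(x_k) Q_t(x_k) = b_1⋯b_t` at every zero `x_k` of `q_{t+1}`**; for PERSYMMETRIC data (`a_i = a_{t−i}`, `b_i = b_{t+1−i}`) this is `q_t(x_k)² = b_1⋯b_t`, so the Favard ∕ Gauss weights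
# `w_k = b_1⋯b_t ∕ (q'_{t+1}(x_k) q_t(x_k))` satisfy **`w_k² q'_{t+1}(x_k)² = b_1⋯b_t`** (`w_k = √(b_1⋯b_t)∕|q'_{t+1}(x_k)|`); CONVERSELY this weight identity at all `t + 1` zeros forces persymmetry
# (Hochstadt's uniqueness N336)

HONEST FRAMING. Part of the Lean index of the computation cell `pub-hsemireg` (seat p10 gen 46, Sunday typer «UNIFORM-IN-n»).  Real polynomials and finite products only; no variety, no cohomology
theory, no sheaf, no Ext group and no semiregularity map is constructed here; nothing here says that HC / HC_CM / HC_AV holds; no Literature fact (unproved `Prop`) is declared or used.  Custodian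
versions as in `WedgeHankelSiegelIdeal` (1/3).
SOURCES (cited).  C. de Boor, G. H. Golub, *The numerically stable reconstruction of a Jacobi matrix from spectral data*, Linear Algebra Appl. 21 (1978) 245–260, §4 (persymmetric case);
H. Hochstadt, *On the construction of a Jacobi matrix from spectral data*, Linear Algebra Appl. 8 (1974) 435–446; B. N. Parlett, *The Symmetric Eigenvalue Problem* (1980), §7-9;
T. S. Chihara, *An Introduction to Orthogonal Polynomials* (1978), Ch. III §4 (numerator ∕ associated polynomials, (4.3)–(4.4)); W. Gautschi, *Orthogonal Polynomials* (2004), §3.1.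
PROOF TYPED HERE.  The associated polynomials `s_n = r_{n+1}` solve the chapter's recurrence with data `(a_{n+1}, b_{n+1})`; the reversal of THAT data at level `t − 1` coincides with `(A, B)`, so
N338 `recurrence_reverse_top_eq` gives `Q_t = s_t = r_{t+1}`; N280 `recurrence_casoratian` at `n = t`; persymmetry makes `Q_n = q_n` (N339 `recurrence_agree_of_coeff_agree`); the converse:
`q_t(x_k)² = b_1⋯b_t = q_t(x_k) Q_t(x_k)` at `t + 1` points forces `q_t = Q_t` (both monic of degree `t`), and `q_{t+1} = Q_{t+1}` (N338), so N336 `recurrence_unique_of_top_two` identifies the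
data.
DEDUP DISCLOSURE (`rg -n -i 'persymm|reverse_eq_second|de boor' Summits/Ventures/HSemireg`, 2026-09-03): N338 (`Q_{t+1} = q_{t+1}`), N280 ∕ N281 (Casoratian, `r`), N336 (Hochstadt); the
identification `Q_t = r_{t+1}`, the product identity at the zeros and the persymmetric weight criterion are new.  The 6 names below: 0 hits tree-wide.

WHAT IS IN THE TREE.  N338 `recurrence_reverse_top_eq`; N280 `recurrence_casoratian`; N339 `recurrence_agree_of_coeff_agree`; N336 `recurrence_unique_of_top_two`; N279 `recurrence_monic_natDegree`;
N273 `natDegree_sub_lt_of_monic_of_natDegree_eq`; Mathlib `Polynomial.eq_zero_of_natDegree_lt_card_of_eval_eq_zero`.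
THIS FILE (namespace `Summit.Ventures.HSemireg.Wedge.HankelOuter` continued; CHAINED on N381 (import only); 0 definitions):
* §1147 **`reverse_eq_secondKind`** (`Q_t = r_{t+1}`), `reverse_casoratian` (`q_t Q_t − q_{t+1} r_t = b_1⋯b_t`), **`eval_mul_reverse_at_zero`** (`q_t(x) Q_t(x) = b_1⋯b_t` at zeros of `q_{t+1}`),
  `persymmetric_reverse_eq` (persymmetric ⇒ `Q_n = q_n`, `n ≤ t + 1`), **`persymmetric_weights`** (`(b_1⋯b_t ∕ (q'_{t+1} q_t)(x))² · q'_{t+1}(x)² = b_1⋯b_t`), **`persymmetric_of_weights`** (converse).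
CAVEATS.  Recurrence language (no matrices); the weights are the chapter's explicit Favard weights of N281; converse under `b_j > 0`.  Nothing Ext-side.  New names only.
-/

open Module Polynomial
open scoped Matrix Polynomial

namespace Summit.Ventures.HSemireg.Wedge.HankelOuter

/-! ## §1147. Reversal = second kind; persymmetric Jacobi data -/

/-- **THE REVERSED RECURRENCE AT LEVEL `t` PRODUCES THE SECOND-KIND POLYNOMIAL: `Q_t = r_{t+1}`.** [Chihara III (4.3); de Boor–Golub 1978; this file, §1147] -/
theorem reverse_eq_secondKind {r Q : ℕ → ℝ[X]} {a b A B : ℕ → ℝ} (hr0 : r 0 = 0) (hr1 : r 1 = 1)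
    (hrrec : ∀ n, r (n + 2) = (Polynomial.X - C (a (n + 1))) * r (n + 1) - C (b (n + 1)) * r n)
    (hQ0 : Q 0 = 1) (hQ1 : Q 1 = Polynomial.X - C (A 0)) (hQrec : ∀ n, Q (n + 2) = (Polynomial.X - C (A (n + 1))) * Q (n + 1) - C (B (n + 1)) * Q n)
    {t : ℕ} (hA : ∀ i, i ≤ t → A i = a (t - i)) (hB : ∀ i, 1 ≤ i → i ≤ t → B i = b (t + 1 - i)) : Q t = r (t + 1) := by
  rcases t with _ | m
  · rw [hQ0, zero_add, hr1]
  · -- the associated polynomials `s_n = r_{n+1}`, data `(a_{n+1}, b_{n+1})`, reversed at level `m`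
    have hs0 : (fun n => r (n + 1)) 0 = 1 := by simp [hr1]
    have hs1 : (fun n => r (n + 1)) 1 = Polynomial.X - C ((fun n => a (n + 1)) 0) := by
      show r (1 + 1) = Polynomial.X - C (a (0 + 1))
      rw [hrrec 0, hr1, hr0, mul_one, mul_zero, sub_zero]
    have hsrec : ∀ n, (fun n => r (n + 1)) (n + 2) = (Polynomial.X - C ((fun n => a (n + 1)) (n + 1))) * (fun n => r (n + 1)) (n + 1) - C ((fun n => b (n + 1)) (n + 1)) * (fun n => r (n + 1)) n :=
      fun n => by show r (n + 2 + 1) = (Polynomial.X - C (a (n + 1 + 1))) * r (n + 1 + 1) - C (b (n + 1 + 1)) * r (n + 1); exact hrrec (n + 1)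
    have h := recurrence_reverse_top_eq (q := fun n => r (n + 1)) (Q := Q) (a := fun n => a (n + 1)) (b := fun n => b (n + 1)) (A := A) (B := B) hs0 hs1 hsrec hQ0 hQ1 hQrec m
      (fun i hi => by show A i = a (m - i + 1); rw [hA i (by omega)]; congr 1; omega) (fun i hi1 hi2 => by show B i = b (m + 1 - i + 1); rw [hB i hi1 (by omega)]; congr 1; omega)
    exact h

/-- **`q_t · Q_t − q_{t+1} · r_t = b_1⋯b_t`** (the Casoratian N280 with `Q_t = r_{t+1}`). [this file, §1147] -/
theorem reverse_casoratian {q r Q : ℕ → ℝ[X]} {a b A B : ℕ → ℝ} (hq0 : q 0 = 1)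
    (hrec : ∀ n, q (n + 2) = (Polynomial.X - C (a (n + 1))) * q (n + 1) - C (b (n + 1)) * q n) (hr0 : r 0 = 0) (hr1 : r 1 = 1)
    (hrrec : ∀ n, r (n + 2) = (Polynomial.X - C (a (n + 1))) * r (n + 1) - C (b (n + 1)) * r n)
    (hQ0 : Q 0 = 1) (hQ1 : Q 1 = Polynomial.X - C (A 0)) (hQrec : ∀ n, Q (n + 2) = (Polynomial.X - C (A (n + 1))) * Q (n + 1) - C (B (n + 1)) * Q n)
    {t : ℕ} (hA : ∀ i, i ≤ t → A i = a (t - i)) (hB : ∀ i, 1 ≤ i → i ≤ t → B i = b (t + 1 - i)) :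
    q t * Q t - q (t + 1) * r t = C (∏ j ∈ Finset.Ico 1 (t + 1), b j) := by
  rw [reverse_eq_secondKind hr0 hr1 hrrec hQ0 hQ1 hQrec hA hB]
  exact recurrence_casoratian hq0 hrec hr0 hr1 hrrec t

/-- **AT EVERY ZERO `x` OF `q_{t+1}`: `q_t(x) · Q_t(x) = b_1⋯b_t`.** [de Boor–Golub 1978 §4; this file, §1147] -/
theorem eval_mul_reverse_at_zero {q r Q : ℕ → ℝ[X]} {a b A B : ℕ → ℝ} (hq0 : q 0 = 1)
    (hrec : ∀ n, q (n + 2) = (Polynomial.X - C (a (n + 1))) * q (n + 1) - C (b (n + 1)) * q n) (hr0 : r 0 = 0) (hr1 : r 1 = 1)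
    (hrrec : ∀ n, r (n + 2) = (Polynomial.X - C (a (n + 1))) * r (n + 1) - C (b (n + 1)) * r n)
    (hQ0 : Q 0 = 1) (hQ1 : Q 1 = Polynomial.X - C (A 0)) (hQrec : ∀ n, Q (n + 2) = (Polynomial.X - C (A (n + 1))) * Q (n + 1) - C (B (n + 1)) * Q n)
    {t : ℕ} (hA : ∀ i, i ≤ t → A i = a (t - i)) (hB : ∀ i, 1 ≤ i → i ≤ t → B i = b (t + 1 - i)) {x : ℝ} (hx : (q (t + 1)).eval x = 0) :
    (q t).eval x * (Q t).eval x = ∏ j ∈ Finset.Ico 1 (t + 1), b j := by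
  have h := congrArg (eval x) (reverse_casoratian hq0 hrec hr0 hr1 hrrec hQ0 hQ1 hQrec hA hB)
  rwa [eval_sub, eval_mul, eval_mul, eval_C, hx, zero_mul, sub_zero] at h

/-- **Persymmetric data (`a_i = a_{t−i}`, `b_i = b_{t+1−i}`): the reversed recurrence coincides with the original up to level `t + 1`.** [this file, §1147] -/
theorem persymmetric_reverse_eq {q Q : ℕ → ℝ[X]} {a b A B : ℕ → ℝ} (hq0 : q 0 = 1) (hq1 : q 1 = Polynomial.X - C (a 0))
    (hrec : ∀ n, q (n + 2) = (Polynomial.X - C (a (n + 1))) * q (n + 1) - C (b (n + 1)) * q n)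
    (hQ0 : Q 0 = 1) (hQ1 : Q 1 = Polynomial.X - C (A 0)) (hQrec : ∀ n, Q (n + 2) = (Polynomial.X - C (A (n + 1))) * Q (n + 1) - C (B (n + 1)) * Q n)
    {t : ℕ} (hA : ∀ i, i ≤ t → A i = a (t - i)) (hB : ∀ i, 1 ≤ i → i ≤ t → B i = b (t + 1 - i))
    (hpa : ∀ i, i ≤ t → a i = a (t - i)) (hpb : ∀ i, 1 ≤ i → i ≤ t → b i = b (t + 1 - i)) : ∀ n, n ≤ t + 1 → Q n = q n := by
  rcases t with _ | m
  · intro n hn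
    rcases n with _ | n
    · rw [hQ0, hq0]
    · have : n = 0 := by omega
      subst this
      rw [hQ1, hq1, hA 0 le_rfl, Nat.sub_zero]
  · exact recurrence_agree_of_coeff_agree (by rw [hQ0, hq0]) (by rw [hQ1, hq1, hA 0 (Nat.zero_le _), ← hpa 0 (Nat.zero_le _)]) hrec hQrec (N := m + 1)
      (fun k _ hk => by rw [hA k (by omega), ← hpa k (by omega)]) (fun k hk1 hk2 => by rw [hB k hk1 (by omega), ← hpb k hk1 (by omega)])

/-- **PERSYMMETRIC ⇒ `w_k = √(b_1⋯b_t)∕|q'_{t+1}(x_k)|`**: with the Favard weight `w = b_1⋯b_t ∕ (q'_{t+1}(x) q_t(x))` (N281) at a zero `x` of `q_{t+1}`, `q_t(x)² = b_1⋯b_t` and `w² · q'_{t+1}(x)² = b_1⋯b_t`.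
[de Boor–Golub 1978 §4; this file, §1147] -/
theorem persymmetric_weights {q r : ℕ → ℝ[X]} {a b : ℕ → ℝ} (hq0 : q 0 = 1) (hq1 : q 1 = Polynomial.X - C (a 0))
    (hrec : ∀ n, q (n + 2) = (Polynomial.X - C (a (n + 1))) * q (n + 1) - C (b (n + 1)) * q n) (hr0 : r 0 = 0) (hr1 : r 1 = 1)
    (hrrec : ∀ n, r (n + 2) = (Polynomial.X - C (a (n + 1))) * r (n + 1) - C (b (n + 1)) * r n) (hb : ∀ j, 0 < b j)
    {t : ℕ} (hpa : ∀ i, i ≤ t → a i = a (t - i)) (hpb : ∀ i, 1 ≤ i → i ≤ t → b i = b (t + 1 - i)) {x : ℝ} (hx : (q (t + 1)).eval x = 0) :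
    (q t).eval x ^ 2 = ∏ j ∈ Finset.Ico 1 (t + 1), b j ∧
      ((∏ j ∈ Finset.Ico 1 (t + 1), b j) / ((derivative (q (t + 1))).eval x * (q t).eval x)) ^ 2 * (derivative (q (t + 1))).eval x ^ 2 = ∏ j ∈ Finset.Ico 1 (t + 1), b j := by
  -- the reversed recurrence exists; it agrees with `q` up to `t + 1`
  obtain ⟨Q, hQ0, hQ1, hQrec⟩ := recurrence_of_coefficients (fun i => a (t - i)) (fun i => b (t + 1 - i))
  have hA : ∀ i, i ≤ t → (fun i => a (t - i)) i = a (t - i) := fun _ _ => rfl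
  have hB : ∀ i, 1 ≤ i → i ≤ t → (fun i => b (t + 1 - i)) i = b (t + 1 - i) := fun _ _ _ => rfl
  have hprod := eval_mul_reverse_at_zero (A := fun i => a (t - i)) (B := fun i => b (t + 1 - i)) hq0 hrec hr0 hr1 hrrec hQ0 hQ1 hQrec hA hB hx
  have hQq := persymmetric_reverse_eq (A := fun i => a (t - i)) (B := fun i => b (t + 1 - i)) hq0 hq1 hrec hQ0 hQ1 hQrec hA hB hpa hpb t (by omega)
  rw [hQq] at hprod
  have hsq : (q t).eval x ^ 2 = ∏ j ∈ Finset.Ico 1 (t + 1), b j := by rw [sq, hprod]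
  refine ⟨hsq, ?_⟩
  have hder : (derivative (q (t + 1))).eval x ≠ 0 := recurrence_root_simple hq0 hq1 hrec hb t hx
  have hqt : (q t).eval x ≠ 0 := fun h0 => by
    rw [h0, zero_mul] at hprod
    exact (Finset.prod_pos fun j _ => hb j).ne' hprod.symm
  field_simp
  rw [hsq, sq]

/-- **CONVERSE (de Boor–Golub ∕ Hochstadt): if at all `t + 1` zeros `x_k` of `q_{t+1}` the Favard weights satisfy `w_k² q'_{t+1}(x_k)² = b_1⋯b_t`, the data are PERSYMMETRIC.** [de Boor–Golub 1978 §4;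
Hochstadt 1974; this file, §1147] -/
theorem persymmetric_of_weights {q r : ℕ → ℝ[X]} {a b : ℕ → ℝ} (hq0 : q 0 = 1) (hq1 : q 1 = Polynomial.X - C (a 0))
    (hrec : ∀ n, q (n + 2) = (Polynomial.X - C (a (n + 1))) * q (n + 1) - C (b (n + 1)) * q n) (hr0 : r 0 = 0) (hr1 : r 1 = 1)
    (hrrec : ∀ n, r (n + 2) = (Polynomial.X - C (a (n + 1))) * r (n + 1) - C (b (n + 1)) * r n) (hb : ∀ j, 0 < b j)
    {t : ℕ} {x : Fin (t + 1) → ℝ} (hxinj : Function.Injective x) (hxr : ∀ k, (q (t + 1)).eval (x k) = 0)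
    (hw : ∀ k, ((∏ j ∈ Finset.Ico 1 (t + 1), b j) / ((derivative (q (t + 1))).eval (x k) * (q t).eval (x k))) ^ 2 * (derivative (q (t + 1))).eval (x k) ^ 2 = ∏ j ∈ Finset.Ico 1 (t + 1), b j) :
    (∀ i, i ≤ t → a i = a (t - i)) ∧ ∀ i, 1 ≤ i → i ≤ t → b i = b (t + 1 - i) := by
  obtain ⟨Q, hQ0, hQ1, hQrec⟩ := recurrence_of_coefficients (fun i => a (t - i)) (fun i => b (t + 1 - i))
  have hA : ∀ i, i ≤ t → (fun i => a (t - i)) i = a (t - i) := fun _ _ => rfl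
  have hB : ∀ i, 1 ≤ i → i ≤ t → (fun i => b (t + 1 - i)) i = b (t + 1 - i) := fun _ _ _ => rfl
  have hPi : 0 < ∏ j ∈ Finset.Ico 1 (t + 1), b j := Finset.prod_pos fun j _ => hb j
  -- at each zero: `q_t(x_k) = Q_t(x_k)`
  have hpt : ∀ k, (q t).eval (x k) = (Q t).eval (x k) := fun k => by
    have hprod := eval_mul_reverse_at_zero (A := fun i => a (t - i)) (B := fun i => b (t + 1 - i)) hq0 hrec hr0 hr1 hrrec hQ0 hQ1 hQrec hA hB (hxr k)
    have hk := hw k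
    have hder : (derivative (q (t + 1))).eval (x k) ≠ 0 := recurrence_root_simple hq0 hq1 hrec hb t (hxr k)
    have hqt : (q t).eval (x k) ≠ 0 := fun h0 => by rw [h0, zero_mul] at hprod; exact hPi.ne' hprod.symm
    have hsq : (q t).eval (x k) ^ 2 = ∏ j ∈ Finset.Ico 1 (t + 1), b j := by
      field_simp at hk
      nlinarith [hk, hPi]
    have : (q t).eval (x k) * (q t).eval (x k) = (q t).eval (x k) * (Q t).eval (x k) := by rw [← sq, hsq, hprod]
    exact mul_left_cancel₀ hqt this
  -- hence `q_t = Q_t`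
  have hmd := recurrence_monic_natDegree hq0 hq1 hrec t
  have hMd := recurrence_monic_natDegree (a := fun i => a (t - i)) (b := fun i => b (t + 1 - i)) hQ0 hQ1 hQrec t
  have hqQ : q t = Q t := by
    rcases Nat.eq_zero_or_pos t with h0 | hpos
    · subst h0; rw [hq0, hQ0]
    · have hd : (q t - Q t).natDegree < t := natDegree_sub_lt_of_monic_of_natDegree_eq hpos hmd.1 hmd.2 hMd.1 hMd.2
      have hz : q t - Q t = 0 := eq_zero_of_natDegree_lt_card_of_eval_eq_zero (q t - Q t) hxinj (fun k => by rw [eval_sub, hpt k, sub_self])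
        (by rw [Fintype.card_fin]; omega)
      exact sub_eq_zero.1 hz
  have htop : q (t + 1) = Q (t + 1) := (recurrence_reverse_top_eq (A := fun i => a (t - i)) (B := fun i => b (t + 1 - i)) hq0 hq1 hrec hQ0 hQ1 hQrec t hA hB).symm
  obtain ⟨ha', hb', -⟩ := recurrence_unique_of_top_two (a' := fun i => a (t - i)) (b' := fun i => b (t + 1 - i)) hq0 hq1 hrec hQ0 hQ1 hQrec (fun j _ => (hb j).ne') t htop hqQ
  exact ⟨fun i hi => ha' i hi, fun i hi1 hi2 => hb' i hi1 hi2⟩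

end Summit.Ventures.HSemireg.Wedge.HankelOuter
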